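import Literature.Analysis.OperatorTheory.RieszProjectionStrongLimit
import Literature.Analysis.OperatorTheory.PseudoResolvent
import HarnessLib

/-!
# Strong limits of operator-valued contour integrals: non-triviality persists
  (the closing step of Albritton–Brué–Colombo 2022, Prop. 2.6 / Thm. 3.1, for general families)

Analysis/OperatorTheory proofs-layer file (theorems only, no definitions, no named facts).
`RieszProjectionStrongLimit.lean` proved, for resolvents of BOUNDED operators, the chain
"`R(λ, T_ℓ) f → R(λ, T_∞) f` uniformly on the circle ⟹ `Pr_ℓ f → Pr_∞ f` ⟹ `Pr_∞ ≠ 0 ⇒ Pr_ℓ ≠ 0`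
eventually". Nothing in that chain uses that the integrands are resolvents of bounded operators:
here it is recorded for ARBITRARY operator-valued families `F n, F : ℂ → E →L[ℂ] E` continuous
on the circle (`tendsto_circleIntegral_apply_of_strong`, `eventually_circleIntegral_ne_zero_of_strong'`),
which is the form needed for the resolvents of the closed, unbounded operators of [ABC]
(pseudo-resolvents, `PseudoResolvent.lean`): `IsPseudoResolvent.eventually_circleIntegral_ne_zero_of_strong`
and `IsPseudoResolvent.eventually_not_closedBall_subset_of_strong` — if the limiting
pseudo-resolvent has a resolvent-eigenvector inside the circle (`J(z)v = (z − μ)⁻¹v`, i.e. an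
eigenvector of the closed operator, `PseudoResolventOperator.lean`), then the Riesz integrals of
the approximating pseudo-resolvents are eventually non-zero, so none of them extends as a
pseudo-resolvent (holomorphically with the resolvent identity) to a neighbourhood of the closed
disc: "since `Pr_∞` is non-trivial, we must have that `Pr_ℓ` is non-trivial for all sufficiently
large `ℓ`", whence spectrum of the approximants inside the curve.

## References

* D. Albritton, E. Brué, M. Colombo, arXiv:2112.03116, end of the proofs of Prop. 2.6 (§2.4) and
  Thm. 3.1 (§3). [AlbrittonBrueColombo2022AnnMath]
* T. Kato, *Perturbation Theory for Linear Operators* (1966), VIII-§1.1–1.2 (strong resolvent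
  convergence, pseudo-resolvents). [Kato1966]
-/

noncomputable section

open Complex MeasureTheory Metric Set Filter Topology

namespace Literature.Analysis.OperatorTheory

variable {E : Type*} [NormedAddCommGroup E] [NormedSpace ℂ E] [CompleteSpace E]

/-- **Strong convergence uniformly on the circle passes to the contour integrals applied to a
vector**: `(∮ F n) f → (∮ F) f`. [cite: AlbrittonBrueColombo2022AnnMath, §2.4 (end of proof of Prop. 2.6) and §3 (proof of Thm. 3.1)] -/
theorem tendsto_circleIntegral_apply_of_strong {ι : Type*} {l : Filter ι} [l.IsCountablyGenerated]
    {F : ι → ℂ → E →L[ℂ] E} {Flim : ℂ → E →L[ℂ] E} {c : ℂ} {R : ℝ} (hR : 0 ≤ R)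
    (hFc : ContinuousOn Flim (sphere c R)) (hFnc : ∀ᶠ n in l, ContinuousOn (F n) (sphere c R))
    (f : E)
    (hconv : TendstoUniformlyOn (fun n z => F n z f) (fun z => Flim z f) l (sphere c R)) :
    Tendsto (fun n => (∮ z in C(c, R), F n z) f) l (𝓝 ((∮ z in C(c, R), Flim z) f)) := by
  have hlim : (∮ z in C(c, R), Flim z) f = ∮ z in C(c, R), Flim z f :=
    circleIntegral_clm_apply (hFc.circleIntegrable hR) f
  have hn : ∀ᶠ n in l, (∮ z in C(c, R), F n z) f = ∮ z in C(c, R), F n z f :=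
    hFnc.mono fun n hn => circleIntegral_clm_apply (hn.circleIntegrable hR) f
  rw [hlim]
  refine (Filter.tendsto_congr' hn).2 ?_
  exact TendstoUniformlyOn.tendsto_circleIntegral_of_continuousOn hR
    (hFnc.mono fun n hn => hn.clm_apply continuousOn_const) hconv

/-- **Non-triviality of the contour integral passes to the approximants** under strong
convergence uniformly on the circle (for every vector): `∮ Flim ≠ 0 ⇒ ∮ F n ≠ 0` eventually
("since `Pr_∞` is non-trivial, we must have that `Pr_ℓ` is non-trivial for all sufficiently
large `ℓ`"). [cite: AlbrittonBrueColombo2022AnnMath, §2.4 (end of proof of Prop. 2.6) and §3 (proof of Thm. 3.1)] -/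
theorem eventually_circleIntegral_ne_zero_of_strong' {ι : Type*} {l : Filter ι}
    [l.IsCountablyGenerated] {F : ι → ℂ → E →L[ℂ] E} {Flim : ℂ → E →L[ℂ] E} {c : ℂ} {R : ℝ}
    (hR : 0 ≤ R) (hFc : ContinuousOn Flim (sphere c R))
    (hFnc : ∀ᶠ n in l, ContinuousOn (F n) (sphere c R))
    (hconv : ∀ f : E, TendstoUniformlyOn (fun n z => F n z f) (fun z => Flim z f) l (sphere c R))
    (hne : (∮ z in C(c, R), Flim z) ≠ 0) :
    ∀ᶠ n in l, (∮ z in C(c, R), F n z) ≠ 0 := by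
  obtain ⟨f, hf⟩ : ∃ f : E, (∮ z in C(c, R), Flim z) f ≠ 0 := by
    by_contra h
    push Not at h
    exact hne (ContinuousLinearMap.ext h)
  have ht := tendsto_circleIntegral_apply_of_strong hR hFc hFnc f (hconv f)
  filter_upwards [ht.eventually_ne hf] with n hn h0
  exact hn (by rw [h0, zero_apply])

namespace IsPseudoResolvent

/-- **Pseudo-resolvent form of the [ABC] closing step**: let `J n` be pseudo-resolvents on open
sets `U n` containing the circle (eventually) and converging strongly to `Jlim`, uniformly on the
circle; if `Jlim` (continuous on the circle) has a resolvent-eigenvector inside —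
`Jlim(z) v = (z − μ)⁻¹ v` on the circle, `v ≠ 0`, `|μ − c| < R`, i.e. `v` is an eigenvector with
eigenvalue `μ` of the closed operator behind `Jlim` — then the Riesz integrals `∮ J n` are
eventually non-zero. [cite: AlbrittonBrueColombo2022AnnMath, §2.4 (end of proof of Prop. 2.6) and §3 (proof of Thm. 3.1)] -/
theorem eventually_circleIntegral_ne_zero_of_strong {ι : Type*} {l : Filter ι}
    [l.IsCountablyGenerated] {J : ι → ℂ → E →L[ℂ] E} {Jlim : ℂ → E →L[ℂ] E} {c : ℂ} {R : ℝ}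
    {μ : ℂ} {v : E} (hμ : μ ∈ ball c R) (hJc : ContinuousOn Jlim (sphere c R))
    (hv : ∀ z ∈ sphere c R, Jlim z v = (z - μ)⁻¹ • v) (hv0 : v ≠ 0)
    (hJnc : ∀ᶠ n in l, ContinuousOn (J n) (sphere c R))
    (hconv : ∀ f : E, TendstoUniformlyOn (fun n z => J n z f) (fun z => Jlim z f) l (sphere c R)) :
    ∀ᶠ n in l, (∮ z in C(c, R), J n z) ≠ 0 :=
  eventually_circleIntegral_ne_zero_of_strong' (dist_nonneg.trans (mem_ball.1 hμ).le) hJc hJnc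
    hconv (circleIntegral_ne_zero_of_apply_eq_inv_smul hμ hJc hv hv0)

/-- **… hence none of the late approximants is a pseudo-resolvent on a neighbourhood of the
closed disc** (their closed operators have spectrum inside the circle): with the hypotheses of
`eventually_circleIntegral_ne_zero_of_strong` and `J n` a pseudo-resolvent on the open set `U n`,
eventually `¬ closedBall c R ⊆ U n`. [cite: AlbrittonBrueColombo2022AnnMath, §2.4 (end of proof of Prop. 2.6) and §3 (proof of Thm. 3.1)] -/
theorem eventually_not_closedBall_subset_of_strong {ι : Type*} {l : Filter ι}
    [l.IsCountablyGenerated] {J : ι → ℂ → E →L[ℂ] E} {U : ι → Set ℂ} {Jlim : ℂ → E →L[ℂ] E}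
    {c : ℂ} {R : ℝ} {μ : ℂ} {v : E} (hJ : ∀ n, IsPseudoResolvent (U n) (J n))
    (hU : ∀ n, IsOpen (U n)) (hμ : μ ∈ ball c R) (hJc : ContinuousOn Jlim (sphere c R))
    (hv : ∀ z ∈ sphere c R, Jlim z v = (z - μ)⁻¹ • v) (hv0 : v ≠ 0)
    (hJnc : ∀ᶠ n in l, ContinuousOn (J n) (sphere c R))
    (hconv : ∀ f : E, TendstoUniformlyOn (fun n z => J n z f) (fun z => Jlim z f) l (sphere c R)) :
    ∀ᶠ n in l, ¬ closedBall c R ⊆ U n := by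
  filter_upwards [eventually_circleIntegral_ne_zero_of_strong hμ hJc hv hv0 hJnc hconv] with n hn
  exact (hJ n).not_closedBall_subset_of_circleIntegral_ne_zero (hU n)
    (dist_nonneg.trans (mem_ball.1 hμ).le) hn

end IsPseudoResolvent

end Literature.Analysis.OperatorTheory
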